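import Mathlib

/-!
# One-Frobenius criteria at `7` for the image condition "Borel or `G(e7)`" of route
# `SqrtFiveQuarticCovers` — kernel-checked `(trace, det)` bookkeeping in `GL₂(𝔽₇)`

Route `Langlands/SqrtFiveQuarticCovers` (cell `pub/lg-quartmod`, F-L1).  The route's 7-clause is:
for some framing, the mod-7 image `G = ρ̄_{E,7}(Γ_K) ≤ GL₂(𝔽₇)` is Borel or lies in
`G(e7) = ⟨(0 5;3 0), (5 0;3 2)⟩` (order 48, index 2 in the normaliser of the non-split Cartan
`𝔽₇[m]ˣ`, `m = (0 5;3 0)·(5 0;3 2) = (1 3;1 0)`, `m̄ = 1 - m = (0 4;6 1)`).  This file proves the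
INCLUSION `G(e7) ⊆ {g : g m = m g, det g ∈ {1,2,4}} ∪ {g : g m = m̄ g, det g ∈ {3,5,6}}`
(`shape_of_mem_Ge7`: Cartan elements of square determinant, anti-Cartan elements of non-square
determinant — in fact an equality, not needed here) and reads off the `(trace, det)` constraints:

* `trace_eq_zero_of_mem_Ge7` — `g ∈ G(e7)`, `det g ∈ {3,5,6}` (non-square) ⇒ `trace g = 0`;
* `trace_sq_ne_det_of_mem_Ge7` — `g ∈ G(e7)` ⇒ `trace(g)² ≠ det g` (true on the whole Cartan
  normaliser: an eigenvalue ratio that is a primitive cube root of unity needs order `9 ∤ 48`);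
* conjugacy-proof kill-lemmas on the 7-clause in conjugation form
  `∃ x, (∀ g ∈ G, (x g x⁻¹)₁₀ = 0) ∨ (∀ g ∈ G, x g x⁻¹ ∈ G(e7))`:
  `not_conj_Ge7_of_witness_nonsquare` (ONE `g ∈ G` with non-square determinant and non-zero
  trace: `N𝔓 ≡ 3, 5, 6 (mod 7)`, `a_𝔓 ≢ 0 (mod 7)`), `not_conj_Ge7_of_witness_trace_sq`
  (`a_𝔓² ≡ N𝔓 (mod 7)`), and `not_borel_or_conj_Ge7_of_witness` ("large at 7" from one element
  with non-square determinant, non-zero trace and non-square `trace² − 4 det`; the Borel half is the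
  discriminant criterion of `SqrtFiveQuarticCoversTraceDetTablesThree`, restated here to keep the
  file self-contained);
* the square tables `isSquare_zmod7_iff`, `isSquare_zmod5_iff`, `isSquare_zmod3_iff` for users;
* (§5, appended) the discriminant form used by the cell's flag `W7ns`: `disc_eq_zero_of_mem_Ge7`
  (non-zero trace and square `trace² − 4 det` force discriminant `0` in `G(e7)`),
  `not_conj_Ge7_of_witness_split`, and the two-witness `not_borel_or_conj_Ge7_of_witnesses`.

Finite group theory only (`decide` over at most three elements of `ZMod 7`); no definitions;
standard axioms; imports only Mathlib.  Nothing here is a statement about elliptic curves: the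
dictionary `(N𝔓, a_𝔓) ↦ (det, trace)` of `ρ̄(Frob_𝔓)` is the user's standard input.
References: [FreitasLeHungSiksek2015] Prop. 1.1(c) (the groups `H₁ = d7`, `H₂ = e7`);
[Box2022] Thm 1.3(iii); [Kalyanswamy2018] Thm 1.2.
-/

set_option linter.dupNamespace false -- project-wide option (lakefile weak.linter.dupNamespace); `Summit.Langlands.Langlands` is the mandated namespace

namespace Summit.Langlands.Langlands.Theorems.SqrtFiveQuarticCovers

open Matrix

/-! ## 1. Square tables in `ZMod 3`, `ZMod 5`, `ZMod 7` (for the users' witnesses) -/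

/-- The squares of `ZMod 3` are `0, 1`. [folklore] -/
theorem isSquare_zmod3_iff (d : ZMod 3) : IsSquare d ↔ d = 0 ∨ d = 1 := by
  constructor
  · rintro ⟨r, rfl⟩; revert r; decide
  · rintro (rfl | rfl)
    exacts [⟨0, by decide⟩, ⟨1, by decide⟩]

/-- The squares of `ZMod 5` are `0, 1, 4`. [folklore] -/
theorem isSquare_zmod5_iff (d : ZMod 5) : IsSquare d ↔ d = 0 ∨ d = 1 ∨ d = 4 := by
  constructor
  · rintro ⟨r, rfl⟩; revert r; decide
  · rintro (rfl | rfl | rfl)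
    exacts [⟨0, by decide⟩, ⟨1, by decide⟩, ⟨2, by decide⟩]

/-- The squares of `ZMod 7` are `0, 1, 2, 4`. [folklore] -/
theorem isSquare_zmod7_iff (d : ZMod 7) : IsSquare d ↔ d = 0 ∨ d = 1 ∨ d = 2 ∨ d = 4 := by
  constructor
  · rintro ⟨r, rfl⟩; revert r; decide
  · rintro (rfl | rfl | rfl | rfl)
    exacts [⟨0, by decide⟩, ⟨1, by decide⟩, ⟨3, by decide⟩, ⟨2, by decide⟩]

/-! ## 2. The shape of the elements of `G(e7)` -/

/-- Every `2 × 2` matrix over `ZMod 7` is `!![a, b; c, d]`. [folklore] -/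
theorem exists_eq_fin_two_zmod7 (M : Matrix (Fin 2) (Fin 2) (ZMod 7)) :
    ∃ a b c d : ZMod 7, M = !![a, b; c, d] :=
  ⟨M 0 0, M 0 1, M 1 0, M 1 1, Matrix.eta_fin_two M⟩

/-- **`G(e7)` by shape (inclusion).** Every element of `G(e7) = ⟨(0 5;3 0), (5 0;3 2)⟩ ≤ GL₂(𝔽₇)`
either commutes with `m = (1 3;1 0)` and has square determinant (`1, 2, 4`), or satisfies
`g m = m̄ g` with `m̄ = (0 4;6 1) = 1 - m` and has non-square determinant (`3, 5, 6`): `G(e7)` is the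
index-2 subgroup `C₂₄ ⊔ (anti-Cartan, non-square det)` of the non-split Cartan normaliser.
[folklore] -/
theorem shape_of_mem_Ge7 {g : GL (Fin 2) (ZMod 7)}
    (hg : g ∈ Subgroup.closure ({(⟨!![0, 5; 3, 0], !![0, 5; 3, 0], by decide, by decide⟩ : GL (Fin 2) (ZMod 7)),
      (⟨!![5, 0; 3, 2], !![3, 0; 6, 4], by decide, by decide⟩ : GL (Fin 2) (ZMod 7))} : Set (GL (Fin 2) (ZMod 7)))) :
    ((g : Matrix (Fin 2) (Fin 2) (ZMod 7)) * !![1, 3; 1, 0] = !![1, 3; 1, 0] * (g : Matrix (Fin 2) (Fin 2) (ZMod 7)) ∧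
        (Matrix.det (g : Matrix (Fin 2) (Fin 2) (ZMod 7)) = 1 ∨ Matrix.det (g : Matrix (Fin 2) (Fin 2) (ZMod 7)) = 2 ∨
          Matrix.det (g : Matrix (Fin 2) (Fin 2) (ZMod 7)) = 4)) ∨
      ((g : Matrix (Fin 2) (Fin 2) (ZMod 7)) * !![1, 3; 1, 0] = !![0, 4; 6, 1] * (g : Matrix (Fin 2) (Fin 2) (ZMod 7)) ∧
        (Matrix.det (g : Matrix (Fin 2) (Fin 2) (ZMod 7)) = 3 ∨ Matrix.det (g : Matrix (Fin 2) (Fin 2) (ZMod 7)) = 5 ∨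
          Matrix.det (g : Matrix (Fin 2) (Fin 2) (ZMod 7)) = 6)) := by
  -- `m̄ = 1 - m`, `m = 1 - m̄`
  have hmb : (!![0, 4; 6, 1] : Matrix (Fin 2) (Fin 2) (ZMod 7)) = 1 - !![1, 3; 1, 0] := by decide
  have hm : (!![1, 3; 1, 0] : Matrix (Fin 2) (Fin 2) (ZMod 7)) = 1 - !![0, 4; 6, 1] := by decide
  have key1 : ∀ U : Matrix (Fin 2) (Fin 2) (ZMod 7), U * !![1, 3; 1, 0] = !![1, 3; 1, 0] * U →
      U * !![0, 4; 6, 1] = !![0, 4; 6, 1] * U := fun U hU => by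
    rw [hmb, Matrix.mul_sub, Matrix.sub_mul, Matrix.mul_one, Matrix.one_mul, hU]
  have key2 : ∀ U : Matrix (Fin 2) (Fin 2) (ZMod 7), U * !![1, 3; 1, 0] = !![0, 4; 6, 1] * U →
      U * !![0, 4; 6, 1] = !![1, 3; 1, 0] * U := fun U hU => by
    calc U * !![0, 4; 6, 1] = U * (1 - !![1, 3; 1, 0]) := by rw [← hmb]
      _ = U - !![0, 4; 6, 1] * U := by rw [Matrix.mul_sub, Matrix.mul_one, hU]
      _ = (1 - !![0, 4; 6, 1]) * U := by rw [Matrix.sub_mul, Matrix.one_mul]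
      _ = !![1, 3; 1, 0] * U := by rw [← hm]
  have key3 : ∀ U : Matrix (Fin 2) (Fin 2) (ZMod 7), U * !![0, 4; 6, 1] = !![1, 3; 1, 0] * U →
      U * !![1, 3; 1, 0] = !![0, 4; 6, 1] * U := fun U hU => by
    calc U * !![1, 3; 1, 0] = U * (1 - !![0, 4; 6, 1]) := by rw [← hm]
      _ = U - !![1, 3; 1, 0] * U := by rw [Matrix.mul_sub, Matrix.mul_one, hU]
      _ = (1 - !![1, 3; 1, 0]) * U := by rw [Matrix.sub_mul, Matrix.one_mul]
      _ = !![0, 4; 6, 1] * U := by rw [← hmb]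
  -- square classes in `𝔽₇ˣ`
  have sq_sq : ∀ d e : ZMod 7, (d = 1 ∨ d = 2 ∨ d = 4) → (e = 1 ∨ e = 2 ∨ e = 4) →
      (d * e = 1 ∨ d * e = 2 ∨ d * e = 4) := by decide
  have sq_nsq : ∀ d e : ZMod 7, (d = 1 ∨ d = 2 ∨ d = 4) → (e = 3 ∨ e = 5 ∨ e = 6) →
      (d * e = 3 ∨ d * e = 5 ∨ d * e = 6) := by decide
  have nsq_sq : ∀ d e : ZMod 7, (d = 3 ∨ d = 5 ∨ d = 6) → (e = 1 ∨ e = 2 ∨ e = 4) →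
      (d * e = 3 ∨ d * e = 5 ∨ d * e = 6) := by decide
  have nsq_nsq : ∀ d e : ZMod 7, (d = 3 ∨ d = 5 ∨ d = 6) → (e = 3 ∨ e = 5 ∨ e = 6) →
      (d * e = 1 ∨ d * e = 2 ∨ d * e = 4) := by decide
  have inv_sq : ∀ d e : ZMod 7, e * d = 1 → (d = 1 ∨ d = 2 ∨ d = 4) → (e = 1 ∨ e = 2 ∨ e = 4) := by decide
  have inv_nsq : ∀ d e : ZMod 7, e * d = 1 → (d = 3 ∨ d = 5 ∨ d = 6) → (e = 3 ∨ e = 5 ∨ e = 6) := by decide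
  -- the target set is a subgroup
  let K : Subgroup (GL (Fin 2) (ZMod 7)) :=
    { carrier := {u | ((u : Matrix (Fin 2) (Fin 2) (ZMod 7)) * !![1, 3; 1, 0] = !![1, 3; 1, 0] * (u : Matrix (Fin 2) (Fin 2) (ZMod 7)) ∧
        (Matrix.det (u : Matrix (Fin 2) (Fin 2) (ZMod 7)) = 1 ∨ Matrix.det (u : Matrix (Fin 2) (Fin 2) (ZMod 7)) = 2 ∨
          Matrix.det (u : Matrix (Fin 2) (Fin 2) (ZMod 7)) = 4)) ∨
      ((u : Matrix (Fin 2) (Fin 2) (ZMod 7)) * !![1, 3; 1, 0] = !![0, 4; 6, 1] * (u : Matrix (Fin 2) (Fin 2) (ZMod 7)) ∧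
        (Matrix.det (u : Matrix (Fin 2) (Fin 2) (ZMod 7)) = 3 ∨ Matrix.det (u : Matrix (Fin 2) (Fin 2) (ZMod 7)) = 5 ∨
          Matrix.det (u : Matrix (Fin 2) (Fin 2) (ZMod 7)) = 6))}
      mul_mem' := by
        rintro u v (⟨hu, du⟩ | ⟨hu, du⟩) (⟨hv, dv⟩ | ⟨hv, dv⟩) <;>
          simp only [Set.mem_setOf_eq, Units.val_mul, Matrix.det_mul]
        · left; refine ⟨?_, sq_sq _ _ du dv⟩
          rw [Matrix.mul_assoc, hv, ← Matrix.mul_assoc, hu, Matrix.mul_assoc]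
        · right; refine ⟨?_, sq_nsq _ _ du dv⟩
          rw [Matrix.mul_assoc, hv, ← Matrix.mul_assoc, key1 _ hu, Matrix.mul_assoc]
        · right; refine ⟨?_, nsq_sq _ _ du dv⟩
          rw [Matrix.mul_assoc, hv, ← Matrix.mul_assoc, hu, Matrix.mul_assoc]
        · left; refine ⟨?_, nsq_nsq _ _ du dv⟩
          rw [Matrix.mul_assoc, hv, ← Matrix.mul_assoc, key2 _ hu, Matrix.mul_assoc]
      one_mem' := Or.inl ⟨by rw [Units.val_one, Matrix.one_mul, Matrix.mul_one], Or.inl (by simp)⟩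
      inv_mem' := by
        intro u hu
        have hdet : Matrix.det ((u⁻¹ : GL (Fin 2) (ZMod 7)) : Matrix (Fin 2) (Fin 2) (ZMod 7)) *
            Matrix.det ((u : GL (Fin 2) (ZMod 7)) : Matrix (Fin 2) (Fin 2) (ZMod 7)) = 1 := by
          rw [← Matrix.det_mul, ← Units.val_mul, inv_mul_cancel, Units.val_one, Matrix.det_one]
        have conj : ∀ A B : Matrix (Fin 2) (Fin 2) (ZMod 7),
            (u : Matrix (Fin 2) (Fin 2) (ZMod 7)) * A = B * (u : Matrix (Fin 2) (Fin 2) (ZMod 7)) →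
            ((u⁻¹ : GL (Fin 2) (ZMod 7)) : Matrix (Fin 2) (Fin 2) (ZMod 7)) * B =
              A * ((u⁻¹ : GL (Fin 2) (ZMod 7)) : Matrix (Fin 2) (Fin 2) (ZMod 7)) := fun A B hAB =>
          calc ((u⁻¹ : GL (Fin 2) (ZMod 7)) : Matrix (Fin 2) (Fin 2) (ZMod 7)) * B
              = ((u⁻¹ : GL (Fin 2) (ZMod 7)) : Matrix (Fin 2) (Fin 2) (ZMod 7)) * B *
                  (((u : GL (Fin 2) (ZMod 7)) : Matrix (Fin 2) (Fin 2) (ZMod 7)) *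
                    ((u⁻¹ : GL (Fin 2) (ZMod 7)) : Matrix (Fin 2) (Fin 2) (ZMod 7))) := by
                rw [← Units.val_mul, mul_inv_cancel, Units.val_one, Matrix.mul_one]
            _ = ((u⁻¹ : GL (Fin 2) (ZMod 7)) : Matrix (Fin 2) (Fin 2) (ZMod 7)) *
                  (((u : GL (Fin 2) (ZMod 7)) : Matrix (Fin 2) (Fin 2) (ZMod 7)) * A) *
                  ((u⁻¹ : GL (Fin 2) (ZMod 7)) : Matrix (Fin 2) (Fin 2) (ZMod 7)) := by
                rw [hAB]; simp only [Matrix.mul_assoc]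
            _ = A * ((u⁻¹ : GL (Fin 2) (ZMod 7)) : Matrix (Fin 2) (Fin 2) (ZMod 7)) := by
                rw [← Matrix.mul_assoc, ← Units.val_mul, inv_mul_cancel, Units.val_one, Matrix.one_mul]
        rcases hu with ⟨hu, du⟩ | ⟨hu, du⟩
        · exact Or.inl ⟨conj _ _ hu, inv_sq _ _ hdet du⟩
        · exact Or.inr ⟨key3 _ (conj _ _ hu), inv_nsq _ _ hdet du⟩ }
  have hle : Subgroup.closure ({(⟨!![0, 5; 3, 0], !![0, 5; 3, 0], by decide, by decide⟩ : GL (Fin 2) (ZMod 7)),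
      (⟨!![5, 0; 3, 2], !![3, 0; 6, 4], by decide, by decide⟩ : GL (Fin 2) (ZMod 7))} : Set (GL (Fin 2) (ZMod 7))) ≤ K := by
    rw [Subgroup.closure_le]
    rintro x hx
    simp only [Set.mem_insert_iff, Set.mem_singleton_iff] at hx
    rcases hx with rfl | rfl
    · right
      exact ⟨by decide, Or.inr (Or.inr (by rw [Matrix.det_fin_two_of]; decide))⟩
    · right
      exact ⟨by decide, Or.inl (by rw [Matrix.det_fin_two_of]; decide)⟩
  exact hle hg

/-! ## 3. The `(trace, det)` constraints on `G(e7)` -/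

/-- **`G(e7)`, non-square determinant ⇒ trace `0`** (these are the anti-Cartan elements
`g m = m̄ g`, of shape `(p q; r -p)`). [folklore] -/
theorem trace_eq_zero_of_mem_Ge7 {g : GL (Fin 2) (ZMod 7)}
    (hg : g ∈ Subgroup.closure ({(⟨!![0, 5; 3, 0], !![0, 5; 3, 0], by decide, by decide⟩ : GL (Fin 2) (ZMod 7)),
      (⟨!![5, 0; 3, 2], !![3, 0; 6, 4], by decide, by decide⟩ : GL (Fin 2) (ZMod 7))} : Set (GL (Fin 2) (ZMod 7))))
    (hd : Matrix.det (g : Matrix (Fin 2) (Fin 2) (ZMod 7)) = 3 ∨ Matrix.det (g : Matrix (Fin 2) (Fin 2) (ZMod 7)) = 5 ∨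
      Matrix.det (g : Matrix (Fin 2) (Fin 2) (ZMod 7)) = 6) :
    Matrix.trace (g : Matrix (Fin 2) (Fin 2) (ZMod 7)) = 0 := by
  rcases shape_of_mem_Ge7 hg with ⟨-, h1⟩ | ⟨hc, -⟩
  · exfalso
    generalize Matrix.det (g : Matrix (Fin 2) (Fin 2) (ZMod 7)) = d at h1 hd
    revert d; decide
  · obtain ⟨p, q, r, s, hm⟩ := exists_eq_fin_two_zmod7 (g : Matrix (Fin 2) (Fin 2) (ZMod 7))
    rw [hm] at hc ⊢
    have h10 := congrArg (fun M : Matrix (Fin 2) (Fin 2) (ZMod 7) => M 1 0) hc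
    simp only [Matrix.mul_fin_two, Matrix.of_apply, Matrix.cons_val', Matrix.cons_val_zero,
      Matrix.cons_val_one, Matrix.cons_val_fin_one, Matrix.empty_val'] at h10
    rw [Matrix.trace_fin_two_of]
    clear hm hc hg hd
    revert p r s h10; decide

/-- **`G(e7)` ⇒ `trace² ≠ det`** (Cartan elements `(r+s 3r; r s)`: the eigenvalue ratio would be
a primitive cube root of unity, order `9 ∤ 48`; anti-Cartan elements: trace `0 ≠ det`). [folklore] -/
theorem trace_sq_ne_det_of_mem_Ge7 {g : GL (Fin 2) (ZMod 7)}
    (hg : g ∈ Subgroup.closure ({(⟨!![0, 5; 3, 0], !![0, 5; 3, 0], by decide, by decide⟩ : GL (Fin 2) (ZMod 7)),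
      (⟨!![5, 0; 3, 2], !![3, 0; 6, 4], by decide, by decide⟩ : GL (Fin 2) (ZMod 7))} : Set (GL (Fin 2) (ZMod 7)))) :
    Matrix.trace (g : Matrix (Fin 2) (Fin 2) (ZMod 7)) ^ 2 ≠ Matrix.det (g : Matrix (Fin 2) (Fin 2) (ZMod 7)) := by
  rcases shape_of_mem_Ge7 hg with ⟨hc, hd⟩ | ⟨-, hd⟩
  · obtain ⟨p, q, r, s, hm⟩ := exists_eq_fin_two_zmod7 (g : Matrix (Fin 2) (Fin 2) (ZMod 7))
    rw [hm] at hc hd ⊢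
    have h00 := congrArg (fun M : Matrix (Fin 2) (Fin 2) (ZMod 7) => M 0 0) hc
    have h10 := congrArg (fun M : Matrix (Fin 2) (Fin 2) (ZMod 7) => M 1 0) hc
    simp only [Matrix.mul_fin_two, Matrix.of_apply, Matrix.cons_val', Matrix.cons_val_zero,
      Matrix.cons_val_one, Matrix.cons_val_fin_one, Matrix.empty_val', mul_one, one_mul,
      mul_zero, zero_mul, add_zero] at h00 h10
    have hq : q = 3 * r := add_left_cancel h00
    subst hq
    rw [Matrix.det_fin_two_of] at hd ⊢
    rw [Matrix.trace_fin_two_of]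
    clear hm hc hg h00
    revert p r s h10 hd; decide
  · rw [trace_eq_zero_of_mem_Ge7 hg hd]
    generalize Matrix.det (g : Matrix (Fin 2) (Fin 2) (ZMod 7)) = d at hd ⊢
    revert d; decide

/-! ## 4. Conjugacy-proof kill-lemmas on the 7-clause -/

/-- **Kill-lemma against `G(e7)`, non-square determinant.** A subgroup containing an element of
non-square determinant and non-zero trace is not conjugate into `G(e7)` (for `ρ̄_{E,7}`: one good
prime with `N𝔓 ≡ 3, 5, 6 (mod 7)` and `a_𝔓(E) ≢ 0 (mod 7)`). [folklore] -/
theorem not_conj_Ge7_of_witness_nonsquare {G : Subgroup (GL (Fin 2) (ZMod 7))} {g : GL (Fin 2) (ZMod 7)}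
    (hg : g ∈ G)
    (hd : Matrix.det (g : Matrix (Fin 2) (Fin 2) (ZMod 7)) = 3 ∨ Matrix.det (g : Matrix (Fin 2) (Fin 2) (ZMod 7)) = 5 ∨
      Matrix.det (g : Matrix (Fin 2) (Fin 2) (ZMod 7)) = 6)
    (ht : Matrix.trace (g : Matrix (Fin 2) (Fin 2) (ZMod 7)) ≠ 0) :
    ¬ ∃ x : GL (Fin 2) (ZMod 7), ∀ g ∈ G, x * g * x⁻¹ ∈
      Subgroup.closure ({(⟨!![0, 5; 3, 0], !![0, 5; 3, 0], by decide, by decide⟩ : GL (Fin 2) (ZMod 7)),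
        (⟨!![5, 0; 3, 2], !![3, 0; 6, 4], by decide, by decide⟩ : GL (Fin 2) (ZMod 7))} : Set (GL (Fin 2) (ZMod 7))) := by
  rintro ⟨x, hx⟩
  have hd' : Matrix.det ((x * g * x⁻¹ : GL (Fin 2) (ZMod 7)) : Matrix (Fin 2) (Fin 2) (ZMod 7)) = 3 ∨
      Matrix.det ((x * g * x⁻¹ : GL (Fin 2) (ZMod 7)) : Matrix (Fin 2) (Fin 2) (ZMod 7)) = 5 ∨
      Matrix.det ((x * g * x⁻¹ : GL (Fin 2) (ZMod 7)) : Matrix (Fin 2) (Fin 2) (ZMod 7)) = 6 := by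
    rw [Units.val_mul, Units.val_mul, Matrix.det_units_conj]; exact hd
  have key := trace_eq_zero_of_mem_Ge7 (hx g hg) hd'
  rw [Units.val_mul, Units.val_mul, Matrix.trace_units_conj] at key
  exact ht key

/-- **Kill-lemma against `G(e7)`, `trace² = det`.** A subgroup containing an element `g` with
`trace(g)² = det g` is not conjugate into `G(e7)` (for `ρ̄_{E,7}`: one good prime with
`a_𝔓(E)² ≡ N𝔓 (mod 7)`). [folklore] -/
theorem not_conj_Ge7_of_witness_trace_sq {G : Subgroup (GL (Fin 2) (ZMod 7))} {g : GL (Fin 2) (ZMod 7)}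
    (hg : g ∈ G)
    (h : Matrix.trace (g : Matrix (Fin 2) (Fin 2) (ZMod 7)) ^ 2 = Matrix.det (g : Matrix (Fin 2) (Fin 2) (ZMod 7))) :
    ¬ ∃ x : GL (Fin 2) (ZMod 7), ∀ g ∈ G, x * g * x⁻¹ ∈
      Subgroup.closure ({(⟨!![0, 5; 3, 0], !![0, 5; 3, 0], by decide, by decide⟩ : GL (Fin 2) (ZMod 7)),
        (⟨!![5, 0; 3, 2], !![3, 0; 6, 4], by decide, by decide⟩ : GL (Fin 2) (ZMod 7))} : Set (GL (Fin 2) (ZMod 7))) := by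
  rintro ⟨x, hx⟩
  refine trace_sq_ne_det_of_mem_Ge7 (hx g hg) ?_
  rw [Units.val_mul, Units.val_mul, Matrix.trace_units_conj, Matrix.det_units_conj]; exact h

/-- **"Large at 7" from one element.** If `g ∈ G` has non-square determinant, non-zero trace and
non-square `trace² − 4 det`, then in NO framing is `G` Borel or inside `G(e7)`: the route's
7-clause fails for `G`.  (For `ρ̄_{E,7}`: `N𝔓 ∈ {3,5,6} mod 7`, `a_𝔓 ≢ 0`, `a_𝔓² − 4N𝔓` a
non-square mod 7 — e.g. `(a_𝔓, N𝔓) ≡ (1, 3)`.) [folklore] -/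
theorem not_borel_or_conj_Ge7_of_witness {G : Subgroup (GL (Fin 2) (ZMod 7))} {g : GL (Fin 2) (ZMod 7)}
    (hg : g ∈ G)
    (hd : Matrix.det (g : Matrix (Fin 2) (Fin 2) (ZMod 7)) = 3 ∨ Matrix.det (g : Matrix (Fin 2) (Fin 2) (ZMod 7)) = 5 ∨
      Matrix.det (g : Matrix (Fin 2) (Fin 2) (ZMod 7)) = 6)
    (ht : Matrix.trace (g : Matrix (Fin 2) (Fin 2) (ZMod 7)) ≠ 0)
    (hns : ¬ IsSquare (Matrix.trace (g : Matrix (Fin 2) (Fin 2) (ZMod 7)) ^ 2 -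
      4 * Matrix.det (g : Matrix (Fin 2) (Fin 2) (ZMod 7)))) :
    ¬ ∃ x : GL (Fin 2) (ZMod 7),
      (∀ g ∈ G, ((x * g * x⁻¹ : GL (Fin 2) (ZMod 7)) : Matrix (Fin 2) (Fin 2) (ZMod 7)) 1 0 = 0) ∨
      (∀ g ∈ G, x * g * x⁻¹ ∈
        Subgroup.closure ({(⟨!![0, 5; 3, 0], !![0, 5; 3, 0], by decide, by decide⟩ : GL (Fin 2) (ZMod 7)),
          (⟨!![5, 0; 3, 2], !![3, 0; 6, 4], by decide, by decide⟩ : GL (Fin 2) (ZMod 7))} : Set (GL (Fin 2) (ZMod 7)))) := by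
  rintro ⟨x, hx | hx⟩
  · -- Borel: `trace² − 4 det = (h₀₀ − h₁₁)²` for the upper-triangular conjugate `h`
    apply hns
    have h10 := hx g hg
    have key : Matrix.trace ((x * g * x⁻¹ : GL (Fin 2) (ZMod 7)) : Matrix (Fin 2) (Fin 2) (ZMod 7)) ^ 2 -
        4 * Matrix.det ((x * g * x⁻¹ : GL (Fin 2) (ZMod 7)) : Matrix (Fin 2) (Fin 2) (ZMod 7)) =
        (((x * g * x⁻¹ : GL (Fin 2) (ZMod 7)) : Matrix (Fin 2) (Fin 2) (ZMod 7)) 0 0 -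
          ((x * g * x⁻¹ : GL (Fin 2) (ZMod 7)) : Matrix (Fin 2) (Fin 2) (ZMod 7)) 1 1) ^ 2 := by
      rw [Matrix.trace_fin_two, Matrix.det_fin_two, h10]; ring
    rw [Units.val_mul, Units.val_mul, Matrix.trace_units_conj, Matrix.det_units_conj] at key
    exact ⟨_, by rw [key, sq]⟩
  · exact not_conj_Ge7_of_witness_nonsquare hg hd ht ⟨x, hx⟩

/-! ## 5. The discriminant form of the non-split criterion (the cell's flag `W7ns`) -/

/-- **`G(e7)`, non-zero trace ⇒ `trace² − 4 det` is `0` or a non-square.**  The Cartan elements of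
`G(e7)` (shape `(r+s 3r; r s)`) have discriminant `trace² − 4 det = -r²`, and `-1` is a non-square
mod `7`; the anti-Cartan elements have trace `0`.  So an element of `G(e7)` with non-zero trace and
SQUARE discriminant is scalar (discriminant `0`). [folklore] -/
theorem disc_eq_zero_of_mem_Ge7 {g : GL (Fin 2) (ZMod 7)}
    (hg : g ∈ Subgroup.closure ({(⟨!![0, 5; 3, 0], !![0, 5; 3, 0], by decide, by decide⟩ : GL (Fin 2) (ZMod 7)),
      (⟨!![5, 0; 3, 2], !![3, 0; 6, 4], by decide, by decide⟩ : GL (Fin 2) (ZMod 7))} : Set (GL (Fin 2) (ZMod 7))))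
    (ht : Matrix.trace (g : Matrix (Fin 2) (Fin 2) (ZMod 7)) ≠ 0)
    (hD : IsSquare (Matrix.trace (g : Matrix (Fin 2) (Fin 2) (ZMod 7)) ^ 2 -
      4 * Matrix.det (g : Matrix (Fin 2) (Fin 2) (ZMod 7)))) :
    Matrix.trace (g : Matrix (Fin 2) (Fin 2) (ZMod 7)) ^ 2 - 4 * Matrix.det (g : Matrix (Fin 2) (Fin 2) (ZMod 7)) = 0 := by
  rcases shape_of_mem_Ge7 hg with ⟨hc, -⟩ | ⟨-, hd⟩
  · obtain ⟨w, hw⟩ := hD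
    obtain ⟨p, q, r, s, hm⟩ := exists_eq_fin_two_zmod7 (g : Matrix (Fin 2) (Fin 2) (ZMod 7))
    rw [hm] at hc hw ⊢
    have h00 := congrArg (fun M : Matrix (Fin 2) (Fin 2) (ZMod 7) => M 0 0) hc
    have h10 := congrArg (fun M : Matrix (Fin 2) (Fin 2) (ZMod 7) => M 1 0) hc
    simp only [Matrix.mul_fin_two, Matrix.of_apply, Matrix.cons_val', Matrix.cons_val_zero,
      Matrix.cons_val_one, Matrix.cons_val_fin_one, Matrix.empty_val', mul_one, one_mul,
      mul_zero, zero_mul, add_zero] at h00 h10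
    have hq : q = 3 * r := add_left_cancel h00
    subst hq
    rw [Matrix.det_fin_two_of, Matrix.trace_fin_two_of] at hw ⊢
    clear hm hc hg ht h00
    revert p r s w h10 hw; decide
  · exact absurd (trace_eq_zero_of_mem_Ge7 hg hd) ht

/-- **Kill-lemma against `G(e7)`, split semisimple witness** (the cell's flag `W7ns`): a subgroup
containing an element with non-zero trace whose discriminant `trace² − 4 det` is a NON-ZERO SQUARE
(two distinct eigenvalues in `𝔽₇`) is not conjugate into `G(e7)` — indeed not into the normaliser of
the non-split Cartan.  (For `ρ̄_{E,7}`: one good prime with `a_𝔓 ≢ 0` and `a_𝔓² − 4N𝔓` a non-zero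
square mod 7.) [folklore] -/
theorem not_conj_Ge7_of_witness_split {G : Subgroup (GL (Fin 2) (ZMod 7))} {g : GL (Fin 2) (ZMod 7)}
    (hg : g ∈ G) (ht : Matrix.trace (g : Matrix (Fin 2) (Fin 2) (ZMod 7)) ≠ 0)
    (hD : IsSquare (Matrix.trace (g : Matrix (Fin 2) (Fin 2) (ZMod 7)) ^ 2 -
      4 * Matrix.det (g : Matrix (Fin 2) (Fin 2) (ZMod 7))))
    (hD0 : Matrix.trace (g : Matrix (Fin 2) (Fin 2) (ZMod 7)) ^ 2 -
      4 * Matrix.det (g : Matrix (Fin 2) (Fin 2) (ZMod 7)) ≠ 0) :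
    ¬ ∃ x : GL (Fin 2) (ZMod 7), ∀ g ∈ G, x * g * x⁻¹ ∈
      Subgroup.closure ({(⟨!![0, 5; 3, 0], !![0, 5; 3, 0], by decide, by decide⟩ : GL (Fin 2) (ZMod 7)),
        (⟨!![5, 0; 3, 2], !![3, 0; 6, 4], by decide, by decide⟩ : GL (Fin 2) (ZMod 7))} : Set (GL (Fin 2) (ZMod 7))) := by
  rintro ⟨x, hx⟩
  apply hD0
  have key := disc_eq_zero_of_mem_Ge7 (hx g hg)
  rw [Units.val_mul, Units.val_mul, Matrix.trace_units_conj, Matrix.det_units_conj] at key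
  exact key ht hD

/-- **"Large at 7" from two elements** (the cell's flags `W7b` + `W7ns`): `g ∈ G` with non-square
discriminant excludes Borel, `g' ∈ G` with non-zero trace and non-zero square discriminant
excludes `G(e7)`; together the route's 7-clause fails for `G` in every framing. [folklore] -/
theorem not_borel_or_conj_Ge7_of_witnesses {G : Subgroup (GL (Fin 2) (ZMod 7))} {g g' : GL (Fin 2) (ZMod 7)}
    (hg : g ∈ G)
    (hns : ¬ IsSquare (Matrix.trace (g : Matrix (Fin 2) (Fin 2) (ZMod 7)) ^ 2 -
      4 * Matrix.det (g : Matrix (Fin 2) (Fin 2) (ZMod 7))))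
    (hg' : g' ∈ G) (ht' : Matrix.trace (g' : Matrix (Fin 2) (Fin 2) (ZMod 7)) ≠ 0)
    (hD' : IsSquare (Matrix.trace (g' : Matrix (Fin 2) (Fin 2) (ZMod 7)) ^ 2 -
      4 * Matrix.det (g' : Matrix (Fin 2) (Fin 2) (ZMod 7))))
    (hD0' : Matrix.trace (g' : Matrix (Fin 2) (Fin 2) (ZMod 7)) ^ 2 -
      4 * Matrix.det (g' : Matrix (Fin 2) (Fin 2) (ZMod 7)) ≠ 0) :
    ¬ ∃ x : GL (Fin 2) (ZMod 7),
      (∀ g ∈ G, ((x * g * x⁻¹ : GL (Fin 2) (ZMod 7)) : Matrix (Fin 2) (Fin 2) (ZMod 7)) 1 0 = 0) ∨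
      (∀ g ∈ G, x * g * x⁻¹ ∈
        Subgroup.closure ({(⟨!![0, 5; 3, 0], !![0, 5; 3, 0], by decide, by decide⟩ : GL (Fin 2) (ZMod 7)),
          (⟨!![5, 0; 3, 2], !![3, 0; 6, 4], by decide, by decide⟩ : GL (Fin 2) (ZMod 7))} : Set (GL (Fin 2) (ZMod 7)))) := by
  rintro ⟨x, hx | hx⟩
  · apply hns
    have h10 := hx g hg
    have key : Matrix.trace ((x * g * x⁻¹ : GL (Fin 2) (ZMod 7)) : Matrix (Fin 2) (Fin 2) (ZMod 7)) ^ 2 -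
        4 * Matrix.det ((x * g * x⁻¹ : GL (Fin 2) (ZMod 7)) : Matrix (Fin 2) (Fin 2) (ZMod 7)) =
        (((x * g * x⁻¹ : GL (Fin 2) (ZMod 7)) : Matrix (Fin 2) (Fin 2) (ZMod 7)) 0 0 -
          ((x * g * x⁻¹ : GL (Fin 2) (ZMod 7)) : Matrix (Fin 2) (Fin 2) (ZMod 7)) 1 1) ^ 2 := by
      rw [Matrix.trace_fin_two, Matrix.det_fin_two, h10]; ring
    rw [Units.val_mul, Units.val_mul, Matrix.trace_units_conj, Matrix.det_units_conj] at key
    exact ⟨_, by rw [key, sq]⟩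
  · exact not_conj_Ge7_of_witness_split hg' ht' hD' hD0' ⟨x, hx⟩

end Summit.Langlands.Langlands.Theorems.SqrtFiveQuarticCovers
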